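import Mathlib
import Literature.AlgebraicGeometry.PlaneCurves.AffineNodalCurves
import Literature.AlgebraicGeometry.Motives.BettiRealization
import HarnessLib

/-!
# Double covers of the Hirzebruch surface `𝔽₂` with nodal branch curve are regular (named fact, four-chart form)

Topic `Literature/AlgebraicGeometry/Surfaces`, namespace `Literature.AlgebraicGeometry.Surfaces.HirzebruchTwoDoublePlane`.
NAMED FACT (`def … : Prop`, NOT proved here) + the light vocabulary needed to state it on the tree's carriers; written by the
prover seat `leafhand-hodge-q8symplecticpowers-4` (g5, cell `pub-hsemireg`) as the print input **S1b** of the registered stub S1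
`stub_regularVeryGeneralQ` of route `HodgeConjecture/Q8SymplecticPowers` (crux K1Q, stmt-HodgeConjecture-24190), whose residue is
VERBATIM (tree theorem `Q8SymplecticPowersRegularOfDoublePlane.stub_regularVeryGeneralQ_of_dense_doublePlaneRegular`, p827228)
«a Zariski-dense set of parameters whose double plane `t² = s·α·ψ` over the chart `{c = s²σc}` of `𝔽₂` has a smooth projective
model with `b₁ = 0`»; the branch curve there is `E + f₀ + f₁ + f₋₁ + f_∞ + Ψ̃ ⊂ 𝔽₂`, nodal for general parameters (design memo
NINTH-HAND-S1-DESIGN-leafhand4-g5 on the item: NO planar model of that surface has a nodal branch curve, so Zariski's theorem on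
`ℙ²` [Zariski1929; Naie2007 Thm. 1] cannot be invoked and the statement must live on `𝔽₂`).

## The printed results and the special case stated

Let `Y` be a smooth projective surface, `B ⊂ Y` a REDUCED curve with at most simple (ADE) singularities, `B ∼ 2L`, `X → Y` the double
cover branched along `B` and `S* → X` its canonical resolution. Then [BarthPetersVandeVen1984, III §7 (double coverings; the
canonical resolution when `B` has at most simple singularities) and V §22 (invariants of double coverings)]
`χ(𝒪_{S*}) = 2χ(𝒪_Y) + ½ L·(L + K_Y)` and `p_g(S*) = p_g(Y) + h⁰(Y, K_Y + L)`, whence (Riemann–Roch on `Y`, `h⁰(Y, −L) = 0`)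
`q(S*) = q(Y) + h¹(Y, −L) = q(Y) + h¹(Y, K_Y + L)` (Serre duality); `b₁(S*) = 2q(S*)` [BarthPetersVandeVen1984, IV §2]; and `b₁` is a
birational invariant of smooth projective surfaces (tree theorem `BettiOneBirationalInvariance.finrank_bettiCohomology_one_eq_of_birationalOver`).
For `Y = 𝔽₂ = ℙ(𝒪 ⊕ 𝒪(−2))` with negative section `E` (`E² = −2`) and fibre `f`: `q(Y) = 0`, `K_Y = −2E − 4f`, and for `a ≥ −1`
`h¹(𝔽₂, 𝒪(aE + bf)) = Σ_{i=0}^{a} h¹(ℙ¹, 𝒪(b − 2i))`, which vanishes iff `b ≥ 2a − 1` (or `a = −1`)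
[Hartshorne1977, V.2 (ruled surfaces: `π_* 𝒪(aC₀) = Sym^a(𝒪 ⊕ 𝒪(−e))`, `R¹π_* 𝒪(aC₀) = 0` for `a ≥ −1`) and III.5 (cohomology of `𝒪_{ℙ¹}(m)`)].
For a reduced `B ∼ αE + γf` (`α = B·f`, `γ = B·σ_∞`, `σ_∞ ∼ E + 2f` the section at infinity) with `α, γ` even and `α ≥ 2`:
`L = (α/2)E + (γ/2)f`, `K + L = (α/2 − 2)E + (γ/2 − 4)f`, and the vanishing condition `γ/2 − 4 ≥ α − 5` reads `γ ≥ 2α − 2`, which holds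
for every reduced `B` (`B·E ≥ 0` if `E ⊄ B`, `(B − E)·E ≥ 0` if `E ⊂ B`). HENCE: **for a reduced nodal `B ⊂ 𝔽₂` with `B·f ≥ 2` and
`B·f`, `B·σ_∞` even, every smooth projective surface birational to the double cover of `𝔽₂` branched along `B` has `b₁ = 0`.**
(`α = 0` is genuinely excluded: `B` = `2m` fibres gives `C × ℙ¹`, `b₁ = 2m − 2`.)

## The tree's carriers (four affine charts of `𝔽₂`; no scheme `𝔽₂` is constructed)

`𝔽₂ ∖ σ_∞ = Tot 𝒪_{ℙ¹}(−2)` has charts `U₁ = (s, y)` and `U₂ = (s′, y′) = (1/s, s²y)`; near `σ_∞`, `U₃ = (s, v) = (s, 1/y)` and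
`U₄ = (s′, v′) = (1/s, 1/(s²y))`; `E = {y = 0} = {y′ = 0}`, `f_∞ = {s′ = 0}`, `σ_∞ = {v = 0} = {v′ = 0}`; `U₁ ∪ ⋯ ∪ U₄ = 𝔽₂`.
A curve is given by its `U₁`-equation `F = Σ c_{ij} sⁱ yʲ ∈ ℂ[s, y]` (variables `X 0 = s`, `X 1 = y`) together with
`α := deg_y F` and `N := max {i − 2j : c_{ij} ≠ 0}` (`IsChartExact α N F`); then `div(F) = B − N·f_∞ − α·σ_∞` on `𝔽₂`
(`div y = E + 2f_∞ − σ_∞`, `div s = f₀ − f_∞`), the other chart equations of `B = closure {F = 0}` are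
`chartTwo N F = Σ c_{ij} s′^{N−i+2j} y′^{j}`, `chartThree α F = Σ c_{ij} sⁱ v^{α−j}`, `chartFour α N F = Σ c_{ij} s′^{N−i+2j} v′^{α−j}`,
`B·f = α`, `B·σ_∞ = N + 2α`, and the branch curve of the normalisation of `𝔽₂` in `ℂ(s,y)(√F)` is `B + (N mod 2)·f_∞` (`α` even:
`σ_∞` unbranched). «Nodal» is the tree's `PlaneCurves.AffineNodalCurves.IsNodal` (every singular point has non-degenerate Hessian;
it forces reducedness) imposed in all four charts, with the factor `s′^{N mod 2}` in the charts meeting `f_∞`. The double cover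
restricted to `U₁` is the affine double plane `Spec ℂ[s, y, t]/(t² − F)` (`DoublePlaneAffineRing F`), so the conclusion is stated
for every smooth projective `X` birational over `ℂ` (Mathlib `Scheme.BirationalOver`) to it, with `b₁ = finrank_ℚ H¹(X(ℂ); ℚ)`
(`Motives.bettiCohomology`).

-- TODO(general form): `q(S*) = q(Y) + h¹(Y, L⁻¹)` for any smooth projective surface `Y` and reduced `B ∈ |2L|` with ADE
-- singularities [BarthPetersVandeVen1984 V §22; EsnaultViehweg1982; Naie2007 Thm. 1 (ℙ², multiplier ideals)]; needs line bundles,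
-- double covers and `q` on the tree's carriers.

Honest scope: a named fact and definitions; nothing is proved here; S1 ∕ K1Q ∕ HC are NOT proved here.

## References
* [BarthPetersVandeVen1984] W. Barth, C. Peters, A. Van de Ven, *Compact Complex Surfaces* (1984), III §7 (cyclic and double
  coverings, canonical resolution), V §22 (invariants of double coverings), IV §2 (`b₁ = 2q`), V §4 (Hirzebruch surfaces).
* [Hartshorne1977] R. Hartshorne, *Algebraic Geometry* (1977), V.2 (ruled surfaces; `Pic`, `K`, `π_*𝒪(aC₀)`), III.5.
* [EsnaultViehweg1982] H. Esnault, E. Viehweg, Revêtements cycliques (1982) (irregularity of cyclic covers via `h¹(Y, L^{(i)−1})`).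
* [Naie2007] D. Naie, The irregularity of cyclic multiple planes after Zariski (2007), Thm. 1 (on `ℙ²`; nodes contribute nothing).
* [Zariski1929] O. Zariski, On the linear connection index of the algebraic surfaces `zⁿ = f(x, y)` (1929).
-/

set_option autoImplicit false

open MvPolynomial AlgebraicGeometry CategoryTheory

namespace Literature.AlgebraicGeometry.Surfaces.HirzebruchTwoDoublePlane

open Literature.AlgebraicGeometry.Motives Literature.AlgebraicGeometry.PlaneCurves.AffineNodalCurves

/-! ### Chart equations of a curve on `𝔽₂` from its `(s, y)`-equation -/

/-- The `U₂ = (s′, y′) = (1/s, s²y)`-equation `Σ c_{ij} s′^{N−i+2j} y′^{j}` of the closure in `𝔽₂` of the affine curve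
`F = Σ c_{ij} sⁱ yʲ = 0`, `N = max (i − 2j)` (`= s′^{N} · F(1/s′, y′s′²)`). [cite: BarthPetersVandeVen1984, V §4 (Hirzebruch surfaces)]
[cite: Hartshorne1977, V.2 (ruled surfaces)] -/
noncomputable def chartTwo (N : ℕ) (F : MvPolynomial (Fin 2) ℂ) : MvPolynomial (Fin 2) ℂ :=
  ∑ m ∈ F.support, monomial (Finsupp.single 0 (N + 2 * m 1 - m 0) + Finsupp.single 1 (m 1)) (coeff m F)

/-- The `U₃ = (s, v) = (s, 1/y)`-equation `Σ c_{ij} sⁱ v^{α−j}` of the closure of `F = 0`, `α = deg_y F` (`= v^{α} · F(s, 1/v)`).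
[cite: BarthPetersVandeVen1984, V §4 (Hirzebruch surfaces)] [cite: Hartshorne1977, V.2 (ruled surfaces)] -/
noncomputable def chartThree (α : ℕ) (F : MvPolynomial (Fin 2) ℂ) : MvPolynomial (Fin 2) ℂ :=
  ∑ m ∈ F.support, monomial (Finsupp.single 0 (m 0) + Finsupp.single 1 (α - m 1)) (coeff m F)

/-- The `U₄ = (s′, v′) = (1/s, 1/(s²y))`-equation `Σ c_{ij} s′^{N−i+2j} v′^{α−j}` of the closure of `F = 0`
(`= s′^{N} v′^{α} · F(1/s′, s′²/v′)`). [cite: BarthPetersVandeVen1984, V §4 (Hirzebruch surfaces)] [cite: Hartshorne1977, V.2 (ruled surfaces)] -/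
noncomputable def chartFour (α N : ℕ) (F : MvPolynomial (Fin 2) ℂ) : MvPolynomial (Fin 2) ℂ :=
  ∑ m ∈ F.support, monomial (Finsupp.single 0 (N + 2 * m 1 - m 0) + Finsupp.single 1 (α - m 1)) (coeff m F)

/-- `α` is EXACTLY the `y`-degree of `F` and `N` is EXACTLY `max {i − 2j}` over the monomials `sⁱyʲ` of `F` — so that
`div(F) = B − N·f_∞ − α·σ_∞` on `𝔽₂`, the chart equations above are not divisible by the boundary variables, `B·f = α`,
`B·σ_∞ = N + 2α`. [cite: Hartshorne1977, V.2 (ruled surfaces: `Pic = ℤC₀ ⊕ ℤf`)] -/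
def IsChartExact (α N : ℕ) (F : MvPolynomial (Fin 2) ℂ) : Prop :=
  (∀ m ∈ F.support, m 1 ≤ α ∧ m 0 ≤ N + 2 * m 1) ∧ (∃ m ∈ F.support, m 1 = α) ∧ (∃ m ∈ F.support, m 0 = N + 2 * m 1)

/-- The coordinate ring `ℂ[s, y, t]/(t² − F)` of the affine double plane over the chart `U₁` (variables `X 0 = s`, `X 1 = y`,
`X 2 = t`). [cite: Zariski1929] [cite: Naie2007, Introduction (the cyclic multiple plane `zⁿ = f(x,y)`)] -/
abbrev DoublePlaneAffineRing (F : MvPolynomial (Fin 2) ℂ) : Type :=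
  MvPolynomial (Fin 3) ℂ ⧸ Ideal.span {(X 2 ^ 2 - rename Fin.castSucc F : MvPolynomial (Fin 3) ℂ)}

/-! ### The named fact -/

/-- **Double covers of `𝔽₂` with nodal branch curve are regular** (special case, four-chart form, of
[BarthPetersVandeVen1984 V §22 with III §7]: for a reduced `B ∼ 2L` with at most simple singularities on a smooth projective
surface `Y`, the canonical resolution `S*` of the double cover has `χ(𝒪_{S*}) = 2χ(𝒪_Y) + ½L(L + K_Y)`,
`p_g(S*) = p_g(Y) + h⁰(K_Y + L)`, hence `q(S*) = q(Y) + h¹(Y, −L)`; combined with `b₁ = 2q` [ibid. IV §2] and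
`h¹(𝔽₂, 𝒪(aE + bf)) = 0` for `a ≥ −1`, `b ≥ 2a − 1` [Hartshorne1977 V.2, III.5]). Statement: let `F ∈ ℂ[s, y]` with exact
`y`-degree `α` and exact `N = max(i − 2j)` (`IsChartExact`), `α` even and `≥ 2` (`σ_∞` unbranched; `α = 0` would give `C × ℙ¹`);
suppose the closure `B` of `{F = 0}` in `𝔽₂`, together with the fibre `f_∞` when `N` is odd, is a NODAL curve — i.e. `F`,
`s′^{N mod 2}·chartTwo N F`, `chartThree α F`, `s′^{N mod 2}·chartFour α N F` are nodal affine curves (`IsNodal`). Then every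
smooth projective surface `X` over `ℂ` birational over `ℂ` to the affine double plane `Spec ℂ[s, y, t]/(t² − F)` has
`b₁(X) = dim_ℚ H¹(X(ℂ); ℚ) = 0`. (Here `B_total ∼ αE + γf`, `γ = N + (N mod 2) + 2α`, `L = (α/2)E + (γ/2)f`,
`K + L = (α/2 − 2)E + (γ/2 − 4)f`, and `γ/2 − 4 ≥ 2(α/2 − 2) − 1` always.)
[cite: BarthPetersVandeVen1984, V §22 (invariants of double coverings) with III §7 (canonical resolution) and IV §2 (b₁ = 2q)]
[cite: Hartshorne1977, V.2 (ruled surfaces) and III.5 (cohomology of projective space)]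
[cite: EsnaultViehweg1982] [cite: Naie2007, Thm. 1] [cite: Zariski1929] -/
def hirzebruchTwo_nodalDoubleCover_bettiOne_eq_zero : Prop :=
  ∀ (F : MvPolynomial (Fin 2) ℂ) (α N : ℕ), Even α → 2 ≤ α → IsChartExact α N F →
    IsNodal F → IsNodal (X 0 ^ (N % 2) * chartTwo N F) → IsNodal (chartThree α F) →
    IsNodal (X 0 ^ (N % 2) * chartFour α N F) →
    ∀ (X : SchemeOver ℂ), IsSmoothProjective 2 X →
      AlgebraicGeometry.Scheme.BirationalOver X.hom
        (Spec.map (CommRingCat.ofHom (algebraMap ℂ (DoublePlaneAffineRing F)))) →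
      Module.finrank ℚ (bettiCohomology X 1) = 0

end Literature.AlgebraicGeometry.Surfaces.HirzebruchTwoDoublePlane
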